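import Mathlib
import Summits.PneNP.PneNP.Theorems.ConvexRankGatesConvexGateBlindExactLiftingTriangle

/-!
# PneNP / ConvexRankGates — `ConvexGateBlind`, line `xor-door-perfect-completeness`:
# asymptotic DEGREE-2 BLINDNESS of the triangle instance, pointer side: the pairing bound for
# interaction-free non-negative column functions (lead c5)

Registered sub-goal `anova2_pairing_bound` of crux item stmt-PneNP-10680 (line
`xor-door-perfect-completeness`, open stub `stub_exactLifting : XorDoor.ExactLifting`).

Context (`…ExactLiftingTriangle.lean`, lead c5 memo `ExactLifting-c5.md` §2).  For the triangle instance
`M_t[x,w] = 1 + 2·[x₀(w₀)=x₁(w₁)=x₂(w₂)]` the question of record is the size of exact non-negative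
factorisations of `M_t − εJ`.  A structured sub-question is DEGREE-2 BLINDNESS: can `M_t − εJ` be written as
`Σ_l a_l ⊗ b_l` with non-negative row functions `a_l(x)` of cross-block Fourier degree `≤ 2`
(`a = α + Σ A⁰¹(π,ρ)s₀π s₁ρ + Σ A¹²(ρ,σ)s₁ρ s₂σ + Σ A⁰²(π,σ)s₀π s₂σ`, `s_iπ = (−1)^{x_i(π)}`) and
non-negative INTERACTION-FREE column functions `b_l` on the pointer cube `[t]³`
(`b(π,ρ,σ) = f(π,ρ) + g(ρ,σ) + h(π,σ)`)?  Exact rational LPs say yes at `t = 2` (`ε ≤ 3/7`) and `t = 3`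
(`ε ≤ 3/31`), with new shapes needed at every `t`.  This file proves the POINTER-SIDE heart of the
asymptotic answer "no":

* `anova2_pairing_bound` (registered): let `α` be real and three real `t × t` matrices give the pair function
  `F(π,ρ,σ) = A⁰¹(π,ρ) + A¹²(ρ,σ) + A⁰²(π,σ)`, and assume the LINE CONDITIONS — on every axis-parallel line
  of `[t]³` the total excess `Σ (F − α)₊` is at most `2α` (for the moment matrices of a non-negative degree-2
  row function these follow from non-negativity on the sub-cubes `{s₀π, s₁ρ, s₂(·) prescribed}`).  Then for
  every non-negative interaction-free `b`:  `t · Σ_w b(w)F(w) ≤ (t + 8)·α·Σ_w b(w)`.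
  Since `Σ_x a(x)[x mono at w] = 2^{3t}(α + F(w))/4`, this says that the `(a ⊗ b)`-weighted density of mono
  entries is `≤ 1/2 + 2/t`, while an exact factorisation of `M_t − εJ` needs weighted density
  `(3−ε)/(6−4ε) = 1/2 + Θ(ε)`: degree-2 ⊗ interaction-free factorisations die for `t > 12/ε − 8` (the
  table-side derivation and the corollary are the companion sub-goal).

Proof (interaction correction).  Put `φ = (F − α)₊ ≥ 0` and
`corr φ = t³φ − t²(L₁+L₂+L₃)φ + t(S₂₃+S₁₃+S₁₂)φ − Σφ` (`L_k` = sum over the line in direction `k`, `S_{jk}` =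
sum over the plane spanned by directions `j,k`; `corr φ = t³ ×` the pure 3-way interaction part of `φ`).
(i) `corr φ` is orthogonal to every function of two coordinates (`sum_pair_mul_corr₀₁/₁₂/₀₂`), hence to
`b`; (ii) pointwise `t³F − corr φ ≤ t³·min(F,α) + t²(L₁+L₂+L₃)φ + Σφ ≤ t³α + 8t²α` by the line conditions
(each line sum of `φ` is `≤ 2α`, so `Σφ ≤ 2t²α`, and the plane sums enter with a minus sign); (iii) pair with
`b ≥ 0`.  The mechanism: a degree-2 row density is uncorrelated with every single-block event, so it cannot
select the tables whose third block is constant along a line — the interaction correction redistributes the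
excess of `F` along lines at cost `O(α/t)`.  Elementary finite sums throughout; no definitions beyond the
file-local bookkeeping `Fpair`, `lineSum₀/₁/₂`, `planeSum₁₂/₀₂/₀₁`, `corr`.
-/

set_option linter.dupNamespace false -- `Summit.PneNP.PneNP.…`: summit = sub-problem (D-0017)

namespace Summit.PneNP.PneNP.Theorems.XorDoor

open scoped BigOperators
open Finset

noncomputable section

namespace TriDegTwo

variable {t : ℕ}

/-! ## §1 Bookkeeping on the pointer cube `Fin t × Fin t × Fin t` -/

/-- The pair function `F(π,ρ,σ) = A⁰¹(π,ρ) + A¹²(ρ,σ) + A⁰²(π,σ)` of three `t × t` matrices. -/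
def Fpair (A01 A12 A02 : Fin t → Fin t → ℝ) (w : Fin t × Fin t × Fin t) : ℝ :=
  A01 w.1 w.2.1 + A12 w.2.1 w.2.2 + A02 w.1 w.2.2

/-- Sum of `ψ` over the line through `w` in direction `0`. -/
def lineSum₀ (ψ : Fin t × Fin t × Fin t → ℝ) (w : Fin t × Fin t × Fin t) : ℝ := ∑ π, ψ (π, w.2.1, w.2.2)

/-- Sum of `ψ` over the line through `w` in direction `1`. -/
def lineSum₁ (ψ : Fin t × Fin t × Fin t → ℝ) (w : Fin t × Fin t × Fin t) : ℝ := ∑ ρ, ψ (w.1, ρ, w.2.2)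

/-- Sum of `ψ` over the line through `w` in direction `2`. -/
def lineSum₂ (ψ : Fin t × Fin t × Fin t → ℝ) (w : Fin t × Fin t × Fin t) : ℝ := ∑ σ, ψ (w.1, w.2.1, σ)

/-- Sum of `ψ` over the plane through `w` spanned by directions `1,2` (first coordinate fixed). -/
def planeSum₁₂ (ψ : Fin t × Fin t × Fin t → ℝ) (w : Fin t × Fin t × Fin t) : ℝ := ∑ ρ, ∑ σ, ψ (w.1, ρ, σ)

/-- Sum of `ψ` over the plane through `w` spanned by directions `0,2` (second coordinate fixed). -/
def planeSum₀₂ (ψ : Fin t × Fin t × Fin t → ℝ) (w : Fin t × Fin t × Fin t) : ℝ := ∑ π, ∑ σ, ψ (π, w.2.1, σ)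

/-- Sum of `ψ` over the plane through `w` spanned by directions `0,1` (third coordinate fixed). -/
def planeSum₀₁ (ψ : Fin t × Fin t × Fin t → ℝ) (w : Fin t × Fin t × Fin t) : ℝ := ∑ π, ∑ ρ, ψ (π, ρ, w.2.2)

/-- `t³ ×` the pure 3-way-interaction part of `ψ` (inclusion–exclusion over the averaging operators). -/
def corr (ψ : Fin t × Fin t × Fin t → ℝ) (w : Fin t × Fin t × Fin t) : ℝ :=
  (t : ℝ) ^ 3 * ψ w - (t : ℝ) ^ 2 * (lineSum₀ ψ w + lineSum₁ ψ w + lineSum₂ ψ w)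
    + (t : ℝ) * (planeSum₁₂ ψ w + planeSum₀₂ ψ w + planeSum₀₁ ψ w) - ∑ v, ψ v

/-- Sums over the pointer cube as iterated sums. -/
theorem sum_cube (ψ : Fin t × Fin t × Fin t → ℝ) :
    ∑ w, ψ w = ∑ π, ∑ ρ, ∑ σ, ψ (π, ρ, σ) := by
  rw [Fintype.sum_prod_type]
  refine Finset.sum_congr rfl fun π _ => ?_
  rw [Fintype.sum_prod_type]

/-! ## §2 The interaction correction is orthogonal to functions of two coordinates -/

/-- Pairing with a function of the coordinates `0,1`. -/
theorem sum_pair_mul_corr₀₁ (f : Fin t → Fin t → ℝ) (ψ : Fin t × Fin t × Fin t → ℝ) :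
    ∑ w : Fin t × Fin t × Fin t, f w.1 w.2.1 * corr ψ w = 0 := by
  -- the six building blocks, all reduced to iterated sums
  have hψ : ∑ w : Fin t × Fin t × Fin t, f w.1 w.2.1 * ψ w = ∑ π, ∑ ρ, f π ρ * ∑ σ, ψ (π, ρ, σ) := by
    rw [sum_cube]; refine Finset.sum_congr rfl fun π _ => Finset.sum_congr rfl fun ρ _ => ?_
    rw [Finset.mul_sum]
  have hL2 : ∑ w : Fin t × Fin t × Fin t, f w.1 w.2.1 * lineSum₂ ψ w =
      (t : ℝ) * ∑ π, ∑ ρ, f π ρ * ∑ σ, ψ (π, ρ, σ) := by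
    rw [sum_cube, Finset.mul_sum]; refine Finset.sum_congr rfl fun π _ => ?_
    rw [Finset.mul_sum]; refine Finset.sum_congr rfl fun ρ _ => ?_
    simp only [lineSum₂, Finset.sum_const, Finset.card_univ, Fintype.card_fin, nsmul_eq_mul]
  have hL0 : ∑ w : Fin t × Fin t × Fin t, f w.1 w.2.1 * lineSum₀ ψ w =
      ∑ π, ∑ ρ, f π ρ * ∑ π', ∑ σ, ψ (π', ρ, σ) := by
    rw [sum_cube]; refine Finset.sum_congr rfl fun π _ => Finset.sum_congr rfl fun ρ _ => ?_
    simp only [lineSum₀]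
    rw [← Finset.mul_sum]
    congr 1
    exact Finset.sum_comm
  have hL1 : ∑ w : Fin t × Fin t × Fin t, f w.1 w.2.1 * lineSum₁ ψ w =
      ∑ π, ∑ ρ, f π ρ * ∑ ρ', ∑ σ, ψ (π, ρ', σ) := by
    rw [sum_cube]; refine Finset.sum_congr rfl fun π _ => Finset.sum_congr rfl fun ρ _ => ?_
    simp only [lineSum₁]
    rw [← Finset.mul_sum]
    congr 1
    exact Finset.sum_comm
  have hP02 : ∑ w : Fin t × Fin t × Fin t, f w.1 w.2.1 * planeSum₀₂ ψ w =
      (t : ℝ) * ∑ π, ∑ ρ, f π ρ * ∑ π', ∑ σ, ψ (π', ρ, σ) := by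
    rw [sum_cube, Finset.mul_sum]; refine Finset.sum_congr rfl fun π _ => ?_
    rw [Finset.mul_sum]; refine Finset.sum_congr rfl fun ρ _ => ?_
    simp only [planeSum₀₂, Finset.sum_const, Finset.card_univ, Fintype.card_fin, nsmul_eq_mul]
  have hP12 : ∑ w : Fin t × Fin t × Fin t, f w.1 w.2.1 * planeSum₁₂ ψ w =
      (t : ℝ) * ∑ π, ∑ ρ, f π ρ * ∑ ρ', ∑ σ, ψ (π, ρ', σ) := by
    rw [sum_cube, Finset.mul_sum]; refine Finset.sum_congr rfl fun π _ => ?_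
    rw [Finset.mul_sum]; refine Finset.sum_congr rfl fun ρ _ => ?_
    simp only [planeSum₁₂, Finset.sum_const, Finset.card_univ, Fintype.card_fin, nsmul_eq_mul]
  have hP01 : ∑ w : Fin t × Fin t × Fin t, f w.1 w.2.1 * planeSum₀₁ ψ w =
      (∑ π, ∑ ρ, f π ρ) * ∑ v, ψ v := by
    rw [sum_cube]
    simp only [planeSum₀₁]
    -- both sides equal `∑ π ρ σ, f π ρ * ∑ π' ρ', ψ (π', ρ', σ)`
    have hsw : ∀ π : Fin t, (∑ ρ, ∑ σ, ψ (π, ρ, σ)) = ∑ σ, ∑ ρ, ψ (π, ρ, σ) := fun π => Finset.sum_comm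
    rw [show (∑ v : Fin t × Fin t × Fin t, ψ v) = ∑ σ, ∑ π', ∑ ρ', ψ (π', ρ', σ) by
      rw [sum_cube]; simp only [hsw]; exact Finset.sum_comm]
    rw [Finset.sum_mul]; refine Finset.sum_congr rfl fun π _ => ?_
    rw [Finset.sum_mul]; refine Finset.sum_congr rfl fun ρ _ => ?_
    rw [Finset.mul_sum]
  have hT : ∑ w : Fin t × Fin t × Fin t, f w.1 w.2.1 * ∑ v, ψ v = (t : ℝ) * ((∑ π, ∑ ρ, f π ρ) * ∑ v, ψ v) := by
    rw [sum_cube]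
    simp only [Finset.sum_const, Finset.card_univ, Fintype.card_fin, nsmul_eq_mul]
    rw [Finset.sum_mul, Finset.mul_sum]; refine Finset.sum_congr rfl fun π _ => ?_
    rw [Finset.sum_mul, Finset.mul_sum]
  -- expand `corr` and combine
  have hexp : ∀ w : Fin t × Fin t × Fin t, f w.1 w.2.1 * corr ψ w =
      (t : ℝ) ^ 3 * (f w.1 w.2.1 * ψ w)
        - (t : ℝ) ^ 2 * (f w.1 w.2.1 * lineSum₀ ψ w + f w.1 w.2.1 * lineSum₁ ψ w + f w.1 w.2.1 * lineSum₂ ψ w)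
        + (t : ℝ) * (f w.1 w.2.1 * planeSum₁₂ ψ w + f w.1 w.2.1 * planeSum₀₂ ψ w + f w.1 w.2.1 * planeSum₀₁ ψ w)
        - f w.1 w.2.1 * ∑ v, ψ v := by
    intro w; simp only [corr]; ring
  simp only [hexp, Finset.sum_sub_distrib, Finset.sum_add_distrib, ← Finset.mul_sum]
  rw [hψ, hL0, hL1, hL2, hP12, hP02, hP01, hT]
  ring

/-- Pairing with a function of the coordinates `1,2`. -/
theorem sum_pair_mul_corr₁₂ (g : Fin t → Fin t → ℝ) (ψ : Fin t × Fin t × Fin t → ℝ) :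
    ∑ w : Fin t × Fin t × Fin t, g w.2.1 w.2.2 * corr ψ w = 0 := by
  -- transport along the relabelling `e w = (w₃, w₁, w₂)`, so that coordinates `1,2` of `e w` are `w₁, w₂`
  let e : Fin t × Fin t × Fin t ≃ Fin t × Fin t × Fin t :=
    { toFun := fun w => (w.2.2, w.1, w.2.1), invFun := fun w => (w.2.1, w.2.2, w.1),
      left_inv := fun _ => rfl, right_inv := fun _ => rfl }
  let ψ' : Fin t × Fin t × Fin t → ℝ := fun v => ψ (e v)
  have key := sum_pair_mul_corr₀₁ g ψ'
  rw [← e.sum_comp]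
  convert key using 2 with w
  -- `corr ψ (e w) = corr ψ' w`: the bookkeeping is symmetric under relabelling the axes
  have hv : ∑ v : Fin t × Fin t × Fin t, ψ' v = ∑ v, ψ v := e.sum_comp ψ
  have hs1 : (∑ ρ, ∑ σ, ψ (σ, w.1, ρ)) = ∑ σ, ∑ ρ, ψ (σ, w.1, ρ) := Finset.sum_comm
  have hs2 : (∑ π, ∑ σ, ψ (σ, π, w.2.1)) = ∑ σ, ∑ π, ψ (σ, π, w.2.1) := Finset.sum_comm
  have hcorr : corr ψ (e w) = corr ψ' w := by
    simp only [corr, lineSum₀, lineSum₁, lineSum₂, planeSum₁₂, planeSum₀₂, planeSum₀₁]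
    rw [hv]
    simp only [ψ', e, Equiv.coe_fn_mk]
    rw [hs1, hs2]
    ring
  rw [hcorr]
  rfl

/-- Pairing with a function of the coordinates `0,2`. -/
theorem sum_pair_mul_corr₀₂ (h : Fin t → Fin t → ℝ) (ψ : Fin t × Fin t × Fin t → ℝ) :
    ∑ w : Fin t × Fin t × Fin t, h w.1 w.2.2 * corr ψ w = 0 := by
  -- transport along `e w = (w₁, w₃, w₂)`, so that coordinates `0,2` of `e w` are `w₁, w₂`
  let e : Fin t × Fin t × Fin t ≃ Fin t × Fin t × Fin t :=
    { toFun := fun w => (w.1, w.2.2, w.2.1), invFun := fun w => (w.1, w.2.2, w.2.1),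
      left_inv := fun _ => rfl, right_inv := fun _ => rfl }
  let ψ' : Fin t × Fin t × Fin t → ℝ := fun v => ψ (e v)
  have key := sum_pair_mul_corr₀₁ h ψ'
  rw [← e.sum_comp]
  convert key using 2 with w
  have hv : ∑ v : Fin t × Fin t × Fin t, ψ' v = ∑ v, ψ v := e.sum_comp ψ
  have hs1 : (∑ ρ, ∑ σ, ψ (w.1, σ, ρ)) = ∑ σ, ∑ ρ, ψ (w.1, σ, ρ) := Finset.sum_comm
  have hcorr : corr ψ (e w) = corr ψ' w := by
    simp only [corr, lineSum₀, lineSum₁, lineSum₂, planeSum₁₂, planeSum₀₂, planeSum₀₁]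
    rw [hv]
    simp only [ψ', e, Equiv.coe_fn_mk]
    rw [hs1]
    ring
  rw [hcorr]
  rfl

/-- The correction is orthogonal to every interaction-free function. -/
theorem sum_anova2_mul_corr (b : Fin t × Fin t × Fin t → ℝ)
    (hb : ∃ f g h : Fin t → Fin t → ℝ, ∀ w, b w = f w.1 w.2.1 + g w.2.1 w.2.2 + h w.1 w.2.2)
    (ψ : Fin t × Fin t × Fin t → ℝ) :
    ∑ w, b w * corr ψ w = 0 := by
  obtain ⟨f, g, h, hfgh⟩ := hb
  simp only [hfgh, add_mul, Finset.sum_add_distrib, sum_pair_mul_corr₀₁, sum_pair_mul_corr₁₂,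
    sum_pair_mul_corr₀₂, add_zero]

/-! ## §3 The pointwise bound under the line conditions -/

/-- Under the line conditions, `t³F − corr φ ≤ t²(t+8)α` pointwise, for `φ = (F − α)₊`. -/
theorem pointwise_bound {α : ℝ} (F : Fin t × Fin t × Fin t → ℝ)
    (h0 : ∀ ρ σ, ∑ π, max (F (π, ρ, σ) - α) 0 ≤ 2 * α)
    (h1 : ∀ π σ, ∑ ρ, max (F (π, ρ, σ) - α) 0 ≤ 2 * α)
    (h2 : ∀ π ρ, ∑ σ, max (F (π, ρ, σ) - α) 0 ≤ 2 * α)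
    (w : Fin t × Fin t × Fin t) :
    (t : ℝ) ^ 3 * F w - corr (fun v => max (F v - α) 0) w ≤ (t : ℝ) ^ 2 * ((t : ℝ) + 8) * α := by
  set φ : Fin t × Fin t × Fin t → ℝ := fun v => max (F v - α) 0 with hφ
  have hφnn : ∀ v, 0 ≤ φ v := fun v => le_max_right _ _
  have ht0 : (0 : ℝ) ≤ t := Nat.cast_nonneg t
  -- line sums ≤ 2α
  have hl0 : lineSum₀ φ w ≤ 2 * α := h0 w.2.1 w.2.2
  have hl1 : lineSum₁ φ w ≤ 2 * α := h1 w.1 w.2.2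
  have hl2 : lineSum₂ φ w ≤ 2 * α := h2 w.1 w.2.1
  -- plane sums ≥ 0
  have hp12 : 0 ≤ planeSum₁₂ φ w := Finset.sum_nonneg fun _ _ => Finset.sum_nonneg fun _ _ => hφnn _
  have hp02 : 0 ≤ planeSum₀₂ φ w := Finset.sum_nonneg fun _ _ => Finset.sum_nonneg fun _ _ => hφnn _
  have hp01 : 0 ≤ planeSum₀₁ φ w := Finset.sum_nonneg fun _ _ => Finset.sum_nonneg fun _ _ => hφnn _
  -- total ≤ 2 t² α (sum of t² line sums in direction 2)
  have htot : ∑ v, φ v ≤ (t : ℝ) ^ 2 * (2 * α) := by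
    rw [sum_cube]
    calc ∑ π, ∑ ρ, ∑ σ, φ (π, ρ, σ) ≤ ∑ _π : Fin t, ∑ _ρ : Fin t, 2 * α :=
          Finset.sum_le_sum fun π _ => Finset.sum_le_sum fun ρ _ => h2 π ρ
      _ = (t : ℝ) ^ 2 * (2 * α) := by
          simp only [Finset.sum_const, Finset.card_univ, Fintype.card_fin, nsmul_eq_mul]; ring
  -- `F − φ ≤ α`
  have hFφ : F w - φ w ≤ α := by
    have : F w - α ≤ φ w := le_max_left _ _
    linarith
  -- assemble
  have hexp : (t : ℝ) ^ 3 * F w - corr φ w =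
      (t : ℝ) ^ 3 * (F w - φ w) + (t : ℝ) ^ 2 * (lineSum₀ φ w + lineSum₁ φ w + lineSum₂ φ w)
        - (t : ℝ) * (planeSum₁₂ φ w + planeSum₀₂ φ w + planeSum₀₁ φ w) + ∑ v, φ v := by
    simp only [corr]; ring
  rw [hexp]
  have ht3 : (0 : ℝ) ≤ (t : ℝ) ^ 3 := by positivity
  have ht2 : (0 : ℝ) ≤ (t : ℝ) ^ 2 := by positivity
  nlinarith [mul_le_mul_of_nonneg_left hFφ ht3,
    mul_le_mul_of_nonneg_left (show lineSum₀ φ w + lineSum₁ φ w + lineSum₂ φ w ≤ 6 * α by linarith) ht2,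
    mul_nonneg ht0 (show 0 ≤ planeSum₁₂ φ w + planeSum₀₂ φ w + planeSum₀₁ φ w by linarith), htot]

/-! ## §4 The pairing bound -/

/-- **The pairing bound.** Under the line conditions on `F` (total excess over `α` at most `2α` on every
axis-parallel line), every non-negative interaction-free `b` has `t·⟨b, F⟩ ≤ (t+8)·α·Σ b`. -/
theorem pairing_bound {α : ℝ} (F : Fin t × Fin t × Fin t → ℝ)
    (h0 : ∀ ρ σ, ∑ π, max (F (π, ρ, σ) - α) 0 ≤ 2 * α)
    (h1 : ∀ π σ, ∑ ρ, max (F (π, ρ, σ) - α) 0 ≤ 2 * α)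
    (h2 : ∀ π ρ, ∑ σ, max (F (π, ρ, σ) - α) 0 ≤ 2 * α)
    (b : Fin t × Fin t × Fin t → ℝ) (hbnn : ∀ w, 0 ≤ b w)
    (hb : ∃ f g h : Fin t → Fin t → ℝ, ∀ w, b w = f w.1 w.2.1 + g w.2.1 w.2.2 + h w.1 w.2.2) :
    (t : ℝ) * ∑ w, b w * F w ≤ ((t : ℝ) + 8) * α * ∑ w, b w := by
  set φ : Fin t × Fin t × Fin t → ℝ := fun v => max (F v - α) 0 with hφ
  have horth : ∑ w, b w * corr φ w = 0 := sum_anova2_mul_corr b hb φ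
  -- `t³ Σ b F = Σ b (t³ F − corr φ) ≤ t²(t+8) α Σ b`
  have hkey : (t : ℝ) ^ 3 * ∑ w, b w * F w ≤ (t : ℝ) ^ 2 * ((t : ℝ) + 8) * α * ∑ w, b w := by
    have hrw : (t : ℝ) ^ 3 * ∑ w, b w * F w = ∑ w, b w * ((t : ℝ) ^ 3 * F w - corr φ w) := by
      rw [Finset.mul_sum]
      have : ∑ w, b w * ((t : ℝ) ^ 3 * F w - corr φ w) = ∑ w, (t : ℝ) ^ 3 * (b w * F w) - ∑ w, b w * corr φ w := by
        rw [← Finset.sum_sub_distrib]; refine Finset.sum_congr rfl fun w _ => ?_; ring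
      rw [this, horth, sub_zero]
    rw [hrw, Finset.mul_sum]
    refine Finset.sum_le_sum fun w _ => ?_
    have := pointwise_bound F h0 h1 h2 w
    calc b w * ((t : ℝ) ^ 3 * F w - corr φ w) ≤ b w * ((t : ℝ) ^ 2 * ((t : ℝ) + 8) * α) :=
          mul_le_mul_of_nonneg_left this (hbnn w)
      _ = (t : ℝ) ^ 2 * ((t : ℝ) + 8) * α * b w := by ring
  -- divide by `t²` (the case `t = 0` is trivial: empty cube)
  rcases Nat.eq_zero_or_pos t with ht | ht
  · subst ht; simp
  · have ht2 : (0 : ℝ) < (t : ℝ) ^ 2 := by positivity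
    have : (t : ℝ) ^ 2 * ((t : ℝ) * ∑ w, b w * F w) ≤ (t : ℝ) ^ 2 * (((t : ℝ) + 8) * α * ∑ w, b w) := by
      calc (t : ℝ) ^ 2 * ((t : ℝ) * ∑ w, b w * F w) = (t : ℝ) ^ 3 * ∑ w, b w * F w := by ring
        _ ≤ (t : ℝ) ^ 2 * ((t : ℝ) + 8) * α * ∑ w, b w := hkey
        _ = (t : ℝ) ^ 2 * (((t : ℝ) + 8) * α * ∑ w, b w) := by ring
    exact le_of_mul_le_mul_left this ht2

end TriDegTwo

/-- **Registered sub-goal `anova2_pairing_bound` of stmt-PneNP-10680** (by name): the pointer-side heart of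
the asymptotic degree-2 blindness of the triangle instance.  For real `α` and three real `t × t` matrices
with pair function `F(π,ρ,σ) = A⁰¹(π,ρ) + A¹²(ρ,σ) + A⁰²(π,σ)` whose excess over `α` sums to at most `2α`
on every axis-parallel line of `[t]³`, every non-negative interaction-free `b = f(π,ρ) + g(ρ,σ) + h(π,σ)`
satisfies `t · Σ_w b(w)F(w) ≤ (t + 8)·α·Σ_w b(w)`. -/
theorem anova2_pairing_bound : ∀ (t : ℕ) (α : ℝ) (A01 A12 A02 : Fin t → Fin t → ℝ),
    (∀ ρ σ, ∑ π, max (A01 π ρ + A12 ρ σ + A02 π σ - α) 0 ≤ 2 * α) →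
    (∀ π σ, ∑ ρ, max (A01 π ρ + A12 ρ σ + A02 π σ - α) 0 ≤ 2 * α) →
    (∀ π ρ, ∑ σ, max (A01 π ρ + A12 ρ σ + A02 π σ - α) 0 ≤ 2 * α) →
    ∀ (b : Fin t × Fin t × Fin t → ℝ), (∀ w, 0 ≤ b w) →
    (∃ f g h : Fin t → Fin t → ℝ, ∀ w, b w = f w.1 w.2.1 + g w.2.1 w.2.2 + h w.1 w.2.2) →
    (t : ℝ) * ∑ w, b w * (A01 w.1 w.2.1 + A12 w.2.1 w.2.2 + A02 w.1 w.2.2) ≤ ((t : ℝ) + 8) * α * ∑ w, b w :=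
  fun _ _ A01 A12 A02 h0 h1 h2 b hbnn hb =>
    TriDegTwo.pairing_bound (TriDegTwo.Fpair A01 A12 A02) h0 h1 h2 b hbnn hb

end

end Summit.PneNP.PneNP.Theorems.XorDoor
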